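import Summits.HodgeConjecture.HodgeConjecture.Theorems.Ring2HypothesesDescentAbsoluteWeakDomination
import Summits.HodgeConjecture.HodgeConjecture.Theorems.Ring2HypothesesDescentAbsoluteCorrespondenceLift
import Summits.HodgeConjecture.HodgeConjecture.Theorems.Ring2HypothesesDescentAlgebraicCorrespondencesSemisimple
import Literature.AlgebraicGeometry.HodgeTheory.MotivatedClassesRationalSpan
import HarnessLib

/-!
# Ring 2 — hypotheses layer, descent axis: ABSOLUTE HODGE CORRESPONDENCES COMPOSE, THE KÜNNETH PROJECTORS ARE ABSOLUTE
# HODGE WITHOUT Deligne's Ex. 2.1 (b), and JANNSEN'S LEMMA for `S(X ⊗ X) := span_ℂ {absolute Hodge classes}`: a nil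
# absolute Hodge endo-correspondence acts as ZERO (mod the six facts of record) — the input of Deligne–Milne II Prop. 6.3 (Note)
# and Prop. 6.5 in operator form (companion `Ring2HypothesesDescentAbsoluteSemisimpleAlgebra`, same gen)

HONEST FRAMING (page 1, verbatim the cell's standing line): **research route conditional on HC_CM; not a
corollary; Q11.4-sentence-2 already refuted in dim ≥ 3.** Nothing in this file proves a case of the Hodge conjecture;
nothing discharges the binder of record b06 `Ring2.Hypotheses.AbsoluteHodgeImpliesAlgebraicAV` («absolute Hodge classes
on complex abelian varieties are algebraic», `Ring2HypothesesDescent.lean` :73; OPEN); the binder table's numbers do not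
move. `HC_CM` (`Theses.RankFourFaces.CMAbelianHodge`) does not occur in this file; row b06 does not occur in this file.

Hodge ladder STAGE 3, `BINDER-OWNERS.md` row **b06**, seat `ring2-b06` (gen 78). The absolute-Hodge twin of ring2-b05
gen 37's `Ring2HypothesesDescentAlgebraicCorrespondencesSemisimple` (Jannsen 1992 / Kleiman 1968: «`B(X) ⟹` the algebra of
algebraic correspondence operators is semisimple»): on the ABSOLUTE road `B(X)` and `C(X)` are automatic (Deligne 1982
Ex. 2.1 (b)–(c); Deligne–Milne II Prop. 6.3, Note: «Note that the proposition shows that `Mor⁰_AH(X,X)` is a semisimple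
ℚ-algebra», Prop. 6.5 «`M_k` is a semisimple Tannakian category over `ℚ`»), so the conclusion is UNCONDITIONAL modulo the
named facts already displayed by gens 76–77: (N) `chartConjugation_canonical`, (E) existence of `σ`-conjugates, V-B3
`deligne1982_cycleClass_absoluteHodge`, T1c `deligne1982_lefschetz_absoluteHodge_iff`, CS7
`deligne1982_cupProduct_absoluteHodge`, CS8 `deligne1982_gysinFst_absoluteHodge`. Printed proof (II 6.3 / 6.5): Hodge
positivity `Tr(u u') > 0`. Proof here: JANNSEN'S route on the real carriers — the trace formula (ring2-b05 gen 36
`gradedTrace_corrAction_comp_smul_one`), «hom ≡ num on `S(X ⊗ X)`» = gen 76's non-degeneracy of the cup pairing on `S`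
(`nondegenerate_span_absoluteHodge`, DM II 6.5 at realisation level), and ABSOLUTE HODGE KÜNNETH PROJECTORS.

* §1 `algebraicClasses_le_span_absoluteHodge` (mod V-B3), `motivatedClasses_le_span_absoluteHodge` (André Prop. 2.5.1 at
  span level — the lane lit-hodgefound theorem `motivatedClasses_le_span_isAbsoluteHodgeClass_of_facts`, mod V-B3 + T1c +
  CS7 + CS8), and **`exists_corrCompClass_mem_span_absoluteHodge` — ABSOLUTE HODGE CORRESPONDENCES COMPOSE**: for
  `γ ∈ S^e(X ⊗ Y)`, `γ' ∈ S^{e'}(Y ⊗ Z)` ONE class `γ'' ∈ S^{e''}(X ⊗ Z)` (`c • p₁₃₊(p₁₂^* γ ∪ p₂₃^* γ')`) with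
  `[γ'']_* = [γ]_* ∘ [γ']_*` in every degree (DM II Prop. 6.1 / §6.3; CS 11.2.7–11.2.8; mod (N)+(E)+V-B3+CS7+CS8).
* §2 **`exists_kunnethProjector_mem_span_absoluteHodge` — `C(X)` FOR ABSOLUTE HODGE CYCLES**: for every `a` a class
  `π ∈ S^n(X ⊗ X)` acting as `id` on `Hᵃ(X(ℂ); ℂ)` and `0` on the other degrees — André's MOTIVATED Künneth projector
  (ring2-b05 `exists_motivated_kunnethProjector`, Prop. 2.2) is in `S` by §1; Deligne's Ex. 2.1 (b)
  (`deligne1982_kunnethComponents_absoluteHodge`) is NOT used (mod V-B3 + T1c + CS7 + CS8).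
* §3 **JANNSEN'S LEMMA FOR `S`**: a class `u ∈ H²ⁿ((X ⊗ X)(ℂ))` with `Tr([w]_*[u]_* | Hᵃ) = 0` for all `w ∈ S^n(X ⊗ X)` and
  all `a` is cup-orthogonal to `S^n(X ⊗ X)` (`cupProduct_eq_zero_of_forall_trace_comp_absoluteHodge_eq_zero`, mod (N)+(E):
  `σ^* S = S`); nil form; hence (§2 + gen 76's non-degeneracy on `X ⊗ X`) **nil ⟹ zero per degree**
  (`corrAction_eq_zero_of_forall_isNilpotent_comp_absoluteHodge`).
* The companion `Ring2HypothesesDescentAbsoluteSemisimpleAlgebra` (same gen) concludes: the operator algebra of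
  `S^n(X ⊗ X)` on each `Hᵃ(X(ℂ); ℂ)` is SEMISIMPLE (DM II Prop. 6.3 (Note) in operator form) and `Hᵃ` is completely reducible under it.

REVISION (gen 78, docstring-only; statements and proofs byte-identical): the semisimplicity Note of Deligne–Milne II
follows PROP. 6.3 (the transpose `u'` and `Tr(uu') > 0`; corpus chunks p0145–p0146), not 6.2 — (6.2) defines the polarisation forms `ψʳ`;
locators corrected after the table pen's reading (lit-reduction g46, INBOX l.1724).

HONEST COLUMN. Nothing is discharged; «10 · 0» unchanged; row b06, `HC_AV`, `HC_CM` do not occur; the six facts are named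
facts OF RECORD occurring only as displayed hypotheses `hN`, `hex`, `hZ`, `hL`, `hcup`, `hgys`; no definition, no new named
fact, no sorry. NOT obtained: the `ℚ`-structure `Mor⁰_AH(X,X)` itself (the tree's `IsAbsoluteHodgeClass` is not additive
without (N)+(E), so the `ℂ`-span is used throughout, as in gens 76–77); DM's positivity `Tr(uu') > 0` (not needed on
Jannsen's route); the Tannakian statement II 6.5 / 6.7 beyond one variety and one degree (quasi-inverses between two
varieties are the companion file's business).

PRESEARCH. «algebra of absolute Hodge self-correspondences semisimple» → [corpus: book:deligne1982-hodge-cycles-motives-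
shimura-varieties p0145 (II (6.2), Prop. 6.3) / p0146 L1–5 (end of Prop. 6.3 and the Note), p0147 L28 / p0148 L5–14 (II Prop. 6.5 and its proof), re-opened
this session]; corpus hybrid «motives for absolute Hodge cycles semisimple Tannakian Jannsen» top = Green–Murre–Voisin
LNM 1594, DM LNM 900, Jannsen LNM 1400, Charles–Schnell; galaxy all stars «absolute Hodge correspondence|absolutely Hodge
correspondence|motives for absolute Hodge» → MN-49 (Charles–Schnell), Jannsen LNM 1400 only — no operator-level statement
on the real carriers in print ⇒ certification by assembly (Jannsen's Lemma 1 route in place of DM's positivity route);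
no novelty in print claimed.

References (bib keys): DeligneMilne1982Tannakian (II Prop. 6.1, (6.2), Prop. 6.3 and Note, Prop. 6.5, Lemma 6.6), Deligne1982HodgeCycles
(§2 Ex. 2.1 (a)–(c), Ex. 2.3), Jannsen1992 (Lemma 1, Thm. 1), Kleiman1968AlgebraicCycles (§1.4 Prop. 1.4.4, §3 Prop. 3.5,
Thm. 3.11), Andre1996Motifs (Prop. 2.2 (p. 16), Prop. 2.5.1 (p. 18), Prop. 3.1 (p. 20)), CharlesSchnell2014Notes
(Def. 11.2.3, Prop. 11.2.7–11.2.8), Fulton1998 (§16.1 Def. 16.1.1, Prop. 16.1.1), FultonYoungTableaux1997 (App. B §B.1).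
-/

noncomputable section

set_option linter.dupNamespace false

open CategoryTheory AlgebraicGeometry MonoidalCategory CartesianMonoidalCategory
open Literature.AlgebraicTopology.SingularHomology Literature.Geometry.Kaehler
open Literature.AlgebraicGeometry Literature.AlgebraicGeometry.Motives
open Literature.AlgebraicGeometry.HodgeTheory
open Summit.HodgeConjecture.HodgeConjecture.Theorems

namespace Summit.HodgeConjecture.HodgeConjecture.Ring2.Hypotheses

/-! ## §1 Algebraic and motivated classes lie in the span; absolute Hodge correspondences compose -/

section Span

variable {l m n : ℕ} {X Y Z : SchemeOver ℂ}

/-- **`Nᵖ H²ᵖ(X(ℂ); ℂ) ⊆ S^p(X)`** (mod V-B3): the coniveau span `algebraicClasses X p` is spanned by its RATIONAL classes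
(`algebraicClasses_le_span_isRationalClass`), and rational algebraic classes are absolute Hodge (Deligne Ex. 2.1 (a), the
named fact `deligne1982_cycleClass_absoluteHodge`, displayed). [cite: Deligne1982HodgeCycles, §2 Example 2.1 (a) (p. 16)]
[cite: CharlesSchnell2014Notes, §11.2.2 («the cohomology class of an algebraic cycle is absolute Hodge»)] -/
theorem algebraicClasses_le_span_absoluteHodge (hZ : deligne1982_cycleClass_absoluteHodge) (hX : IsSmoothProjective n X)
    (p : ℕ) :
    algebraicClasses X p ≤ Submodule.span ℂ {c : complexBetti X (2 * p) | IsAbsoluteHodgeClass n X p c} :=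
  (algebraicClasses_le_span_isRationalClass hX p).trans (Submodule.span_mono fun c hc ↦ hZ hX p c hc.1 hc.2)

/-- **`A_motᵖ(X)_ℂ ⊆ S^p(X)`** — André's Prop. 2.5.1 at the level of `ℂ`-spans (the lane theorem
`motivatedClasses_le_span_isAbsoluteHodgeClass_of_facts`: a generator `pr_{X*}(α ∪ *_L β)` with rational algebraic `α`, `β`
is absolute Hodge by Ex. 2.1 (a), Ex. 2.1 (c), CS 11.2.7 (1) and CS 11.2.8 (1)), mod V-B3 + T1c + CS7 + CS8.
[cite: Andre1996Motifs, Prop. 2.5.1 (p. 18)] [cite: Deligne1982HodgeCycles, §2 Example 2.1 (a), (c) (p. 16)] -/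
theorem motivatedClasses_le_span_absoluteHodge (hZ : deligne1982_cycleClass_absoluteHodge)
    (hL : deligne1982_lefschetz_absoluteHodge_iff) (hcup : deligne1982_cupProduct_absoluteHodge)
    (hgys : deligne1982_gysinFst_absoluteHodge) (hX : IsSmoothProjective n X) (p : ℕ) :
    motivatedClasses n X p ≤ Submodule.span ℂ {c : complexBetti X (2 * p) | IsAbsoluteHodgeClass n X p c} :=
  (motivatedClasses_le_span_isAbsoluteHodgeClass_of_facts hZ hL hcup hgys hX p).trans
    (Submodule.span_mono fun _ hc ↦ hc.2)

/-- **ABSOLUTE HODGE CORRESPONDENCES COMPOSE, with ONE class in every degree** (Deligne–Milne II Prop. 6.1 and §6.3,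
`Hom(h(Y), h(X)) = Mor_AH(Y, X)`, composition as in Fulton Def. 16.1.1), mod (N)+(E) + V-B3 + CS7 + CS8. For smooth
projective `X, Y, Z` (dimensions `l, m, n`), `γ ∈ S^e(X ⊗ Y)`, `γ' ∈ S^{e'}(Y ⊗ Z)` and `e + e' = e'' + m` there is
`γ'' ∈ S^{e''}(X ⊗ Z)` with `[γ'']_* = [γ]_* ∘ [γ']_*` on `Hᵃ(Z(ℂ))` for EVERY `a` (complex orientations): the class
`c • p₁₃₊(p₁₂^* γ ∪ p₂₃^* γ')` of ring2-b05's `exists_corrCompClass_total` (uniform Gysin base change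
`gysin_baseChange_uniform`, `corr_comp_of_baseChange`), which lies in `S` because pull-backs
(`map_mem_span_absoluteHodge_of_canonical`), cup products (`cupProduct_mem_span_absoluteHodge`) and the Gysin map of every
morphism (`complexGysin_mem_span_absoluteHodge`) preserve `S`.
-- adapted from Summits/…/Theorems/Ring2HypothesesDescentMotivatedTotalOperators.lean (`exists_corrCompClass_total`)
[cite: DeligneMilne1982Tannakian, II Prop. 6.1 and §6.3 (construction of the category of motives)]
[cite: Fulton1998, §16.1 Def. 16.1.1 and Prop. 16.1.1] [cite: CharlesSchnell2014Notes, Prop. 11.2.7 (1) and Prop. 11.2.8 (1)–(2)] -/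
theorem exists_corrCompClass_mem_span_absoluteHodge (hN : chartConjugation_canonical)
    (hex : ∀ ⦃n : ℕ⦄ ⦃X : SchemeOver ℂ⦄, IsSmoothProjective n X →
      ∀ (σ : ℂ ≃+* ℂ) (p : ℕ) (c : complexBetti X (2 * p)), ∃ s, IsConjugateClass σ X (2 * p) c s)
    (hZ : deligne1982_cycleClass_absoluteHodge) (hcup : deligne1982_cupProduct_absoluteHodge)
    (hgys : deligne1982_gysinFst_absoluteHodge) (hX : IsSmoothProjective l X) (hY : IsSmoothProjective m Y)
    (hZ' : IsSmoothProjective n Z) {e e' e'' : ℕ} (he : e + e' = e'' + m) {γ : complexBetti (X ⊗ Y) (2 * e)}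
    {γ' : complexBetti (Y ⊗ Z) (2 * e')}
    (hγ : γ ∈ Submodule.span ℂ {c : complexBetti (X ⊗ Y) (2 * e) | IsAbsoluteHodgeClass (l + m) (X ⊗ Y) e c})
    (hγ' : γ' ∈ Submodule.span ℂ {c : complexBetti (Y ⊗ Z) (2 * e') | IsAbsoluteHodgeClass (m + n) (Y ⊗ Z) e' c}) :
    ∃ γ'' ∈ Submodule.span ℂ {c : complexBetti (X ⊗ Z) (2 * e'') | IsAbsoluteHodgeClass (l + n) (X ⊗ Z) e'' c},
      ∀ {a a₁ a₂ : ℕ} (h₁ : a + 2 * e' = a₁ + 2 * n) (h₂ : a₁ + 2 * e = a₂ + 2 * m)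
        (h₃ : a + 2 * e'' = a₂ + 2 * n),
        corrAction complexOrientationFamily hX hZ' h₃ γ'' =
          corrAction complexOrientationFamily hX hY h₂ γ ∘ₗ corrAction complexOrientationFamily hY hZ' h₁ γ' := by
  have hμ : complexOrientationFamily.HasPoincareDuality := OrientationFamily.hasPoincareDuality _
  obtain ⟨c, hc⟩ := gysin_baseChange_uniform complexOrientationFamily hX hY hZ'
  have hYZ := IsSmoothProjective.tensor_holds hY hZ'
  have hXY := IsSmoothProjective.tensor_holds hX hY
  have hXZ := IsSmoothProjective.tensor_holds hX hZ'
  have hT := IsSmoothProjective.tensor_holds hX (IsSmoothProjective.tensor_holds hY hZ')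
  -- the three constituents lie in `S(X ⊗ (Y ⊗ Z))`
  have h₁₂ : complexBetti.map (X ◁ fst Y Z) (2 * e) γ ∈
      Submodule.span ℂ {c : complexBetti (X ⊗ (Y ⊗ Z)) (2 * e) |
        IsAbsoluteHodgeClass (l + (m + n)) (X ⊗ (Y ⊗ Z)) e c} :=
    map_mem_span_absoluteHodge_of_canonical hN hex hT hXY (X ◁ fst Y Z) e hγ
  have h₂₃ : complexBetti.map (snd X (Y ⊗ Z)) (2 * e') γ' ∈
      Submodule.span ℂ {c : complexBetti (X ⊗ (Y ⊗ Z)) (2 * e') |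
        IsAbsoluteHodgeClass (l + (m + n)) (X ⊗ (Y ⊗ Z)) e' c} :=
    map_mem_span_absoluteHodge_of_canonical hN hex hT hYZ (snd X (Y ⊗ Z)) e' hγ'
  have hprod := cupProduct_mem_span_absoluteHodge hcup hT ((Nat.mul_add 2 e e').symm : 2 * e + 2 * e' = 2 * (e + e'))
    h₁₂ h₂₃
  have hpush := complexGysin_mem_span_absoluteHodge hN hex hZ hcup hgys hT hXZ (X ◁ snd Y Z)
    (show 2 * (e + e') + 2 * (l + n) = 2 * e'' + 2 * (l + (m + n)) by omega) hprod
  refine ⟨c • complexGysin complexOrientationFamily hT hXZ (X ◁ snd Y Z)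
      (show 2 * (e + e') + 2 * (l + n) = 2 * e'' + 2 * (l + (m + n)) by omega)
      (cupProduct ((Nat.mul_add 2 e e').symm : 2 * e + 2 * e' = 2 * (e + e'))
        (complexBetti.map (X ◁ fst Y Z) (2 * e) γ) (complexBetti.map (snd X (Y ⊗ Z)) (2 * e') γ')),
    Submodule.smul_mem _ _ hpush, fun {a a₁ a₂} h₁ h₂ h₃ ↦ ?_⟩
  refine LinearMap.ext fun y ↦ ?_
  rw [LinearMap.comp_apply, corrAction_apply, corrAction_apply, corrAction_apply]
  exact corr_comp_of_baseChange hμ hX hY hZ' h₁ h₂ (show 2 * e + 2 * e' = 2 * e'' + 2 * m by omega)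
    ((Nat.mul_add 2 e e').symm) γ γ' c (fun z ↦ hc _ z) y

end Span

/-! ## §2 `C(X)` for absolute Hodge cycles: the Künneth projectors lie in `S(X ⊗ X)` -/

section Kunneth

variable {n : ℕ} {X : SchemeOver ℂ}

/-- **THE KÜNNETH PROJECTORS ARE ABSOLUTE HODGE (span form), WITHOUT Deligne's Ex. 2.1 (b)** — mod V-B3 + T1c + CS7 +
CS8: for every smooth projective complex `X` of dimension `n` and every degree `a` there is `π ∈ S^n(X ⊗ X)` with
`[π]_* = id` on `Hᵃ(X(ℂ); ℂ)` and `[π]_* = 0` on `H^{a'}(X(ℂ); ℂ)`, `a' ≠ a` (complex orientations). André's Prop. 2.2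
makes the Künneth projectors MOTIVATED (ring2-b05's `exists_motivated_kunnethProjector`, Kleiman's two-ended induction),
and motivated classes lie in `S` (§1, André Prop. 2.5.1 at span level). In print for absolute Hodge cycles: Deligne 1982
Ex. 2.1 (b) «the `πⁱ` are absolute Hodge cycles» — recorded in the tree as the named fact
`deligne1982_kunnethComponents_absoluteHodge`, which is NOT a hypothesis here. [cite: Deligne1982HodgeCycles, §2 Example 2.1 (b) (p. 15)]
[cite: Andre1996Motifs, Prop. 2.2 (p. 16) and Prop. 2.5.1 (p. 18)] [cite: Kleiman1968AlgebraicCycles, §1.4 Prop. 1.4.4] -/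
theorem exists_kunnethProjector_mem_span_absoluteHodge (hZ : deligne1982_cycleClass_absoluteHodge)
    (hL : deligne1982_lefschetz_absoluteHodge_iff) (hcup : deligne1982_cupProduct_absoluteHodge)
    (hgys : deligne1982_gysinFst_absoluteHodge) (hX : IsSmoothProjective n X) (a : ℕ) :
    ∃ π ∈ Submodule.span ℂ {c : complexBetti (X ⊗ X) (2 * n) | IsAbsoluteHodgeClass (n + n) (X ⊗ X) n c},
      ∀ a' : ℕ, corrAction complexOrientationFamily hX hX (rfl : a' + 2 * n = a' + 2 * n) π =
        if a' = a then LinearMap.id else 0 := by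
  obtain ⟨π, hπ, hact⟩ := exists_motivated_kunnethProjector complexOrientationFamily hX a
  exact ⟨π, motivatedClasses_le_span_absoluteHodge hZ hL hcup hgys (IsSmoothProjective.tensor_holds hX hX) n hπ, hact⟩

/-- **The diagonal class lies in `S^n(X ⊗ X)` and acts as the identity in every degree** (mod V-B3): `[Δ] = (𝟙, 𝟙)_* 1`
is algebraic (ring2-b05's `corrAction_diagonalClass`), hence in `S` (§1). [cite: Deligne1982HodgeCycles, §2 Example 2.1 (a), (b) (p. 15)]
[cite: FultonYoungTableaux1997, Appendix B §B.1 (2), (5)] -/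
theorem exists_diagonalClass_mem_span_absoluteHodge (hZ : deligne1982_cycleClass_absoluteHodge)
    (hX : IsSmoothProjective n X) :
    ∃ δ ∈ Submodule.span ℂ {c : complexBetti (X ⊗ X) (2 * n) | IsAbsoluteHodgeClass (n + n) (X ⊗ X) n c},
      ∀ a : ℕ, corrAction complexOrientationFamily hX hX (rfl : a + 2 * n = a + 2 * n) δ = LinearMap.id :=
  ⟨_, algebraicClasses_le_span_absoluteHodge hZ (IsSmoothProjective.tensor_holds hX hX) n
      (corrAction_diagonalClass complexOrientationFamily hX 0).1,
    fun a ↦ (corrAction_diagonalClass complexOrientationFamily hX a).2⟩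

end Kunneth

/-! ## §3 Jannsen's lemma for `S`: trace-orthogonal classes are cup-orthogonal to `S(X ⊗ X)`; nil ⟹ zero per degree -/

section Jannsen

variable (μ : OrientationFamily) {n : ℕ} {X : SchemeOver ℂ}

/-- **JANNSEN'S LEMMA against `S^n(X ⊗ X)`, on the real carriers** (mod (N)+(E) only). For `X` smooth projective of
dimension `n`, an orientation family `μ` and ANY class `u ∈ H²ⁿ((X ⊗ X)(ℂ); ℂ)`: if `Tr([w]_* ∘ [u]_* | Hᵃ(X(ℂ))) = 0`
for every `w ∈ S^n(X ⊗ X)` and every `a ≤ 2n`, then `u ∪ v = 0` for every `v ∈ S^n(X ⊗ X)`. Trace formula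
`p₁₊ p₂^* p₁₊(u ∪ σ^* w) = (Σₐ (-1)ᵃ Tr) · 1` (ring2-b05 gen 36, `gradedTrace_corrAction_comp_smul_one`) with `w = σ^* v`,
which lies in `S` because pull-backs preserve `S` (`map_mem_span_absoluteHodge_of_canonical` for the swap `σ = β`), `σ^* σ^* = id`,
and injectivity of the reading (`eq_zero_of_fibreIntegral_fst_eq_zero`). Verbatim ring2-b05 gen 37's
`cupProduct_eq_zero_of_forall_trace_comp_algebraic_eq_zero` with `Aⁿ(X ⊗ X)_ℂ ↦ S^n(X ⊗ X)`.
-- adapted from Summits/…/Theorems/Ring2HypothesesDescentAlgebraicCorrespondencesSemisimple.lean (§1)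
[cite: Jannsen1992, Lemma 1] [cite: Kleiman1968AlgebraicCycles, §1.3 Prop. 1.3.6] [cite: DeligneMilne1982Tannakian, II Prop. 6.3 (Note)] -/
theorem cupProduct_eq_zero_of_forall_trace_comp_absoluteHodge_eq_zero (hN : chartConjugation_canonical)
    (hex : ∀ ⦃n : ℕ⦄ ⦃X : SchemeOver ℂ⦄, IsSmoothProjective n X →
      ∀ (σ : ℂ ≃+* ℂ) (p : ℕ) (c : complexBetti X (2 * p)), ∃ s, IsConjugateClass σ X (2 * p) c s)
    (hX : IsSmoothProjective n X) {u : complexBetti (X ⊗ X) (2 * n)}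
    (h : ∀ w ∈ Submodule.span ℂ {c : complexBetti (X ⊗ X) (2 * n) | IsAbsoluteHodgeClass (n + n) (X ⊗ X) n c},
      ∀ a ≤ 2 * n,
      LinearMap.trace ℂ _ (corrAction μ hX hX (rfl : a + 2 * n = a + 2 * n) w ∘ₗ
        corrAction μ hX hX (rfl : a + 2 * n = a + 2 * n) u) = 0) :
    ∀ v ∈ Submodule.span ℂ {c : complexBetti (X ⊗ X) (2 * n) | IsAbsoluteHodgeClass (n + n) (X ⊗ X) n c},
      cupProduct (show 2 * n + 2 * n = 2 * (n + n) by omega) u v = 0 := by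
  intro v hv
  have hXX := IsSmoothProjective.tensor_holds hX hX
  have hσv : complexBetti.map (β_ X X).hom (2 * n) v ∈
      Submodule.span ℂ {c : complexBetti (X ⊗ X) (2 * n) | IsAbsoluteHodgeClass (n + n) (X ⊗ X) n c} :=
    map_mem_span_absoluteHodge_of_canonical hN hex hXX hXX (β_ X X).hom n hv
  have hvv : v = complexBetti.map (β_ X X).hom (2 * n) (complexBetti.map (β_ X X).hom (2 * n) v) := by
    rw [← complexBetti.map_comp_apply', SymmetricCategory.symmetry, complexBetti.map_id]
    rfl
  rw [hvv]
  refine eq_zero_of_fibreIntegral_fst_eq_zero μ hX ?_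
  rw [← gradedTrace_corrAction_comp_smul_one μ hX u, Finset.sum_eq_zero, zero_smul]
  intro a ha
  rw [h _ hσv a (by simpa [Nat.lt_succ_iff] using Finset.mem_range.mp ha), mul_zero]

/-- **Nil form**: if `[w]_* ∘ [u]_*` is nilpotent on every `Hᵃ(X(ℂ))` for every `w ∈ S^n(X ⊗ X)`, then `u` is cup-orthogonal
to `S^n(X ⊗ X)` (nilpotent operators have trace `0`); in particular every element of a nil left ideal of the algebra of
absolute Hodge endo-correspondences is `≡_num 0` on `S`. [cite: Jannsen1992, Lemma 1] [cite: DeligneMilne1982Tannakian, II Prop. 6.3 (Note)] -/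
theorem cupProduct_eq_zero_of_forall_isNilpotent_comp_absoluteHodge (hN : chartConjugation_canonical)
    (hex : ∀ ⦃n : ℕ⦄ ⦃X : SchemeOver ℂ⦄, IsSmoothProjective n X →
      ∀ (σ : ℂ ≃+* ℂ) (p : ℕ) (c : complexBetti X (2 * p)), ∃ s, IsConjugateClass σ X (2 * p) c s)
    (hX : IsSmoothProjective n X) {u : complexBetti (X ⊗ X) (2 * n)}
    (h : ∀ w ∈ Submodule.span ℂ {c : complexBetti (X ⊗ X) (2 * n) | IsAbsoluteHodgeClass (n + n) (X ⊗ X) n c},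
      ∀ a ≤ 2 * n,
      IsNilpotent (corrAction μ hX hX (rfl : a + 2 * n = a + 2 * n) w ∘ₗ
        corrAction μ hX hX (rfl : a + 2 * n = a + 2 * n) u)) :
    ∀ v ∈ Submodule.span ℂ {c : complexBetti (X ⊗ X) (2 * n) | IsAbsoluteHodgeClass (n + n) (X ⊗ X) n c},
      cupProduct (show 2 * n + 2 * n = 2 * (n + n) by omega) u v = 0 :=
  cupProduct_eq_zero_of_forall_trace_comp_absoluteHodge_eq_zero μ hN hex hX fun w hw a ha ↦
    (LinearMap.isNilpotent_trace_of_isNilpotent (h w hw a ha)).eq_zero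

/-- **Nil ⟹ zero per degree for ABSOLUTE HODGE endo-correspondences** (mod the six facts; complex orientations). For
`u ∈ S^n(X ⊗ X)`: if `[w]_* ∘ [u]_*` is nilpotent on `Hᵃ(X(ℂ); ℂ)` for every `w ∈ S^n(X ⊗ X)`, then `[u]_* = 0` on `Hᵃ`. The
composite `u ∘ πᵃ` with the absolute Hodge Künneth projector (§2, `exists_kunnethProjector_mem_span_absoluteHodge`; §1
composition) lies in `S^n(X ⊗ X)`, acts as `[u]_*` on `Hᵃ` and `0` elsewhere, so all its traces against `S` vanish, it is
cup-orthogonal to `S^n(X ⊗ X)` (Jannsen's lemma), hence `0` by the NON-DEGENERACY of the cup pairing on `S(X ⊗ X)`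
(gen 76's `nondegenerate_span_absoluteHodge` = DM II 6.5 at realisation level — «hom ≡ num» needs no `D(X)` here).
-- adapted from Summits/…/Theorems/Ring2HypothesesDescentAlgebraicCorrespondencesSemisimple.lean (§2)
[cite: Jannsen1992, Lemma 1] [cite: Kleiman1968AlgebraicCycles, §1.4 Prop. 1.4.4 and §3 Prop. 3.5]
[cite: DeligneMilne1982Tannakian, II Prop. 6.3 (Note) and Prop. 6.5] -/
theorem corrAction_eq_zero_of_forall_isNilpotent_comp_absoluteHodge (hN : chartConjugation_canonical)
    (hex : ∀ ⦃n : ℕ⦄ ⦃X : SchemeOver ℂ⦄, IsSmoothProjective n X →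
      ∀ (σ : ℂ ≃+* ℂ) (p : ℕ) (c : complexBetti X (2 * p)), ∃ s, IsConjugateClass σ X (2 * p) c s)
    (hZ : deligne1982_cycleClass_absoluteHodge) (hL : deligne1982_lefschetz_absoluteHodge_iff)
    (hcup : deligne1982_cupProduct_absoluteHodge) (hgys : deligne1982_gysinFst_absoluteHodge)
    (hX : IsSmoothProjective n X) {a : ℕ} {u : complexBetti (X ⊗ X) (2 * n)}
    (hu : u ∈ Submodule.span ℂ {c : complexBetti (X ⊗ X) (2 * n) | IsAbsoluteHodgeClass (n + n) (X ⊗ X) n c})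
    (h : ∀ w ∈ Submodule.span ℂ {c : complexBetti (X ⊗ X) (2 * n) | IsAbsoluteHodgeClass (n + n) (X ⊗ X) n c},
      IsNilpotent (corrAction complexOrientationFamily hX hX (rfl : a + 2 * n = a + 2 * n) w ∘ₗ
        corrAction complexOrientationFamily hX hX (rfl : a + 2 * n = a + 2 * n) u)) :
    corrAction complexOrientationFamily hX hX (rfl : a + 2 * n = a + 2 * n) u = 0 := by
  have hXX := IsSmoothProjective.tensor_holds hX hX
  obtain ⟨π, hπS, hπa⟩ := exists_kunnethProjector_mem_span_absoluteHodge hZ hL hcup hgys hX a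
  obtain ⟨u', hu'S, hact⟩ := exists_corrCompClass_mem_span_absoluteHodge hN hex hZ hcup hgys hX hX hX
    (e := n) (e' := n) (e'' := n) rfl hu hπS
  have hact' : ∀ a' : ℕ, corrAction complexOrientationFamily hX hX (rfl : a' + 2 * n = a' + 2 * n) u' =
      corrAction complexOrientationFamily hX hX (rfl : a' + 2 * n = a' + 2 * n) u ∘ₗ
        (if a' = a then LinearMap.id else 0) := fun a' ↦ by
    rw [hact (a := a') (a₁ := a') (a₂ := a') rfl rfl rfl, hπa a']
  -- all traces of `u'` against `S` vanish, so `u'` is cup-orthogonal to `S`, so `u' = 0`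
  have hu'0 : u' = 0 := by
    refine (nondegenerate_span_absoluteHodge hZ hL hcup hXX (show n + n = n + n from rfl)).1 u' hu'S
      (cupProduct_eq_zero_of_forall_isNilpotent_comp_absoluteHodge complexOrientationFamily hN hex hX fun w hw a' _ ↦ ?_)
    rw [hact' a']
    split_ifs with haa
    · subst haa
      rw [LinearMap.comp_id]
      exact h w hw
    · rw [LinearMap.comp_zero, LinearMap.comp_zero]
      exact IsNilpotent.zero
  have hfin := hact' a
  rw [hu'0, map_zero, if_pos rfl, LinearMap.comp_id] at hfin
  exact hfin.symm

end Jannsen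

end Summit.HodgeConjecture.HodgeConjecture.Ring2.Hypotheses

end
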